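import Literature.Probability.RandomPlanarGeometry.SLERestrictionLemmas
import Literature.Probability.RandomPlanarGeometry.LoewnerGrowth
import Literature.Analysis.Complex.KoebeQuarterProofs
import Literature.Analysis.Complex.KoebeDistortion
import HarnessLib

/-!
# Hitting of a hull by the closed Loewner hulls: hit points and wholly swallowed components

Deterministic facts about the chordal Loewner chain of a CONTINUOUS driving function `W`
(`LoewnerChain`: swallowing times `T_z = swallowingTime W z`, maps `g_t = map W t`; closed hulls
`K̂_t = closedHull W t = {z ∈ ℍ̄ : T_z ≤ t}` of `SLERestrictionLemmas`) at the hitting time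
`T = inf{t : K̂_t ∩ A ≠ ∅}` of a compact set `A` (`Loewner.IsHullHitTime`), which form the first
paragraph of the printed proof of

* G. F. Lawler, O. Schramm, W. Werner, *Conformal restriction: the chordal case*, J. Amer. Math.
  Soc. **16** (2003) 917–955 (**[LSW]**), Lemma 6.3 ("We first argue the rather obvious fact
  `K_T ∩ A ⊂ ∂A` …"),

proved here without harmonic measure:

* `Loewner.isClosed_closedHull` — `K̂_t` is closed (lower semicontinuity of `z ↦ T_z`,
  `isOpen_setOf_lt_swallowingTime`); `Loewner.IsHullHitTime.exists_mem_closedHull` — at the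
  hitting time some point of the compact set `A` is swallowed: `A ∩ K̂_T ≠ ∅` (Cantor's
  intersection theorem for `A ∩ K̂_{T + 1/(n+1)}`);
* `Loewner.norm_map_sub_driving_lt_of_swallowingTime_eq`,
  `Loewner.tendsto_map_sub_driving_of_swallowingTime_eq` — **a point swallowed at the finite
  time `τ` is carried onto the driving function: `g_t(z) - W_t → 0` as `t ↗ τ`** (full limit,
  not only `inf = 0`): by the flow cocycle (`map_add`, `coe_add_lt_swallowingTime`) the point
  `g_t(z)` is swallowed by the shifted chain `W(t + ·)` within time `τ - t`, so Lawler's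
  Lemma 4.13 (`lt_swallowingTime_of_far`) bounds `|g_t(z) - W_t| < osc_{[t,τ]} W + 4√(τ - t)`;
* `Loewner.swallowingTime_eq_or_lt_of_isPreconnected` — **wholly swallowed components**: if an
  open connected `V ⊆ ℍ` misses `K̂_s` for every `s < τ`, then either every point of `V` is
  swallowed exactly at time `τ`, or none is. (If `T_z = τ` and `B(z, r) ⊆ V`, the maps
  `f_t = g_t - W_t`, univalent on `B(z, r)` with values in `ℍ`, have `f_t(z) → 0`, so Koebe's
  one-quarter theorem (`koebeQuarter_holds`, rescaled) forces `r |f_t'(z)|/4 ≤ Im f_t(z) → 0`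
  and the growth theorem (`distortion_half_ball`) gives `f_t → 0` on `B(z, r/2)`, whose points
  are therefore swallowed by time `τ`.) This is the mechanism behind "`K_T ∩ A ⊂ ∂A`" for hulls
  whose interior is connected and reaches the non-swallowed real points of `A` (drawn for Jordan
  arc hulls downstream, `LoewnerHullHittingArc`).

## References

* [LSW] Lemma 6.3 and its proof (first paragraph), p. 14 of arXiv:math/0209343.
* G. F. Lawler, *Conformally Invariant Processes in the Plane*, AMS (2005), §4.1, Lemma 4.13,
  Rem. 4.9.
-/

noncomputable section

open Set Filter Metric Complex
open _root_.Topology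
open UpperHalfPlane (upperHalfPlaneSet isOpen_upperHalfPlaneSet)
open scoped NNReal

namespace Literature.Probability.RandomPlanarGeometry

namespace Loewner

variable {W : ℝ≥0 → ℝ} {z : ℂ}

/-! ### The closed hulls are closed; hit points exist -/

/-- The sublevel sets `{z | T_z ≤ t}` of the swallowing time are closed (continuous driving
function): complement of the open set `{z | t < T_z}` (`isOpen_setOf_lt_swallowingTime`). [folklore] -/
theorem isClosed_setOf_swallowingTime_le (hW : Continuous W) (t : ℝ≥0) :
    IsClosed {z : ℂ | swallowingTime W z ≤ (t : WithTop ℝ≥0)} := by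
  have h := (isOpen_setOf_lt_swallowingTime hW t).isClosed_compl
  convert h using 1
  ext z
  simp only [mem_setOf_eq, mem_compl_iff, not_lt]

/-- **The closed Loewner hull `K̂_t = {z ∈ ℍ̄ : T_z ≤ t}` is closed** for a continuous driving
function (lower semicontinuity of the swallowing time). [folklore] -/
theorem isClosed_closedHull (hW : Continuous W) (t : ℝ≥0) : IsClosed (closedHull W t) := by
  rw [closedHull, setOf_and]
  exact (isClosed_le continuous_const Complex.continuous_im).inter
    (isClosed_setOf_swallowingTime_le hW t)

/-- **At the hitting time of a compact set some of its points are swallowed**: if `τ` is the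
hitting time of the compact `A` by the closed hulls (`IsHullHitTime`: `K̂_s ∩ A = ∅` for
`s < τ`, `≠ ∅` for `s > τ`), then `A ∩ K̂_τ ≠ ∅` — Cantor's intersection theorem for the
decreasing nonempty compact sets `A ∩ K̂_{τ + 1/(n+1)}`, whose intersection is `A ∩ K̂_τ`.
([LSW] proof of Lemma 6.3: "Let `z₀` be some point in `∂A ∩ K_T`.") [folklore] -/
theorem IsHullHitTime.exists_mem_closedHull (hW : Continuous W) {A : Set ℂ} (hA : IsCompact A)
    {τ : ℝ≥0} (h : IsHullHitTime W A τ) : ∃ z ∈ A, z ∈ closedHull W τ := by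
  set s : ℕ → ℝ≥0 := fun n ↦ τ + ((n : ℝ≥0) + 1)⁻¹ with hs
  set F : ℕ → Set ℂ := fun n ↦ A ∩ closedHull W (s n) with hF
  have hsτ : ∀ n, τ < s n := fun n ↦ lt_add_of_pos_right _ (inv_pos.2 (by positivity))
  have hanti : ∀ n, F (n + 1) ⊆ F n := fun n ↦ by
    refine inter_subset_inter_right _ (closedHull_mono W ?_)
    change τ + (((n + 1 : ℕ) : ℝ≥0) + 1)⁻¹ ≤ τ + ((n : ℝ≥0) + 1)⁻¹
    push_cast
    gcongr
    exact le_add_of_nonneg_right zero_le_one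
  have hne : ∀ n, (F n).Nonempty := fun n ↦ by
    obtain ⟨x, hxK, hxA⟩ := Set.not_disjoint_iff.1 (h.2 (s n) (hsτ n))
    exact ⟨x, hxA, hxK⟩
  have hcl : ∀ n, IsClosed (F n) := fun n ↦ hA.isClosed.inter (isClosed_closedHull hW _)
  have h0 : IsCompact (F 0) := hA.inter_right (isClosed_closedHull hW _)
  obtain ⟨z, hz⟩ :=
    IsCompact.nonempty_iInter_of_sequence_nonempty_isCompact_isClosed F hanti hne h0 hcl
  rw [mem_iInter] at hz
  refine ⟨z, (hz 0).1, (hz 0).2.1, ?_⟩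
  -- `T_z ≤ τ + 1/(n+1)` for all `n`
  have hle : ∀ n, swallowingTime W z ≤ ((s n : ℝ≥0) : WithTop ℝ≥0) := fun n ↦ (hz n).2.2
  induction hT : swallowingTime W z with
  | top =>
    exact absurd (hT ▸ hle 0) (not_le.2 (WithTop.coe_lt_top _))
  | coe a =>
    rw [WithTop.coe_le_coe, ← NNReal.coe_le_coe]
    have hle' : ∀ n : ℕ, (a : ℝ) ≤ (τ : ℝ) + 1 / ((n : ℝ) + 1) := fun n ↦ by
      have h1 := hle n
      rw [hT, WithTop.coe_le_coe, ← NNReal.coe_le_coe] at h1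
      simpa [hs, one_div] using h1
    have hlim : Tendsto (fun n : ℕ ↦ (τ : ℝ) + 1 / ((n : ℝ) + 1)) atTop (𝓝 (τ : ℝ)) := by
      have h1 : Tendsto (fun n : ℕ ↦ 1 / ((n : ℝ) + 1)) atTop (𝓝 (0 : ℝ)) :=
        tendsto_one_div_add_atTop_nhds_zero_nat
      simpa using (tendsto_const_nhds (x := (τ : ℝ))).add h1
    exact ge_of_tendsto' hlim hle'

/-! ### A swallowed point is carried onto the driving function -/

/-- **Quantitative form**: if `z ∈ H_t` is swallowed at the finite time `τ` (`T_z = τ`), and on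
`[t, τ]` the driving function stays within `M` of `W_t` while `4(τ - t) ≤ δ²`, `δ > 0`, then
`|g_t(z) - W_t| < M + 2δ`. Indeed `g_t(z)` is swallowed by the shifted chain `W(t + ·)` exactly
at time `τ - t` (cocycle, `coe_add_lt_swallowingTime`), which Lawler's Lemma 4.13
(`lt_swallowingTime_of_far`) forbids for points farther than `M + 2δ` from `W_t`.
[cite: Lawler2005, Lemma 4.13 and Rem. 4.9] -/
theorem norm_map_sub_driving_lt_of_swallowingTime_eq (hW : Continuous W) {t τ : ℝ≥0}
    (hzt : z ∈ domain W t) (hτ : swallowingTime W z = τ) {M δ : ℝ}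
    (hM : ∀ u ∈ Icc (t : ℝ) τ, |W u.toNNReal - W t| ≤ M) (hδ : 0 < δ)
    (hδt : 4 * ((τ : ℝ) - t) ≤ δ ^ 2) : ‖map W t z - W t‖ < M + 2 * δ := by
  by_contra hle
  rw [not_lt] at hle
  have htτ : t < τ := by
    have := ((mem_domain_iff W t z).1 hzt).2
    rw [hτ] at this
    exact WithTop.coe_lt_coe.1 this
  set r : ℝ≥0 := τ - t with hr
  have hrcoe : (r : ℝ) = τ - t := by rw [hr, NNReal.coe_sub htτ.le]
  have hM' : ∀ u ∈ Icc (0 : ℝ) r, ‖(((fun v ↦ W (t + v)) u.toNNReal : ℝ) : ℂ) - (W t : ℂ)‖ ≤ M := by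
    intro u hu
    rw [← Complex.ofReal_sub, Complex.norm_real, Real.norm_eq_abs]
    have h1 := hM (t + u) ⟨by linarith [hu.1], by rw [hrcoe] at hu; linarith [hu.2]⟩
    have h2 : ((t : ℝ) + u).toNNReal = t + u.toNNReal := by
      rw [Real.toNNReal_add t.coe_nonneg hu.1, Real.toNNReal_coe]
    rwa [h2] at h1
  have hδr : 4 * (r : ℝ) ≤ δ ^ 2 := by rwa [hrcoe]
  have h1 := (lt_swallowingTime_of_far (z := map W t z) (continuous_shift W hW t) hM' hδ hδr
    hle).1
  have h2 := coe_add_lt_swallowingTime hW hzt h1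
  rw [hτ, hr, add_tsub_cancel_of_le htτ.le] at h2
  exact lt_irrefl _ h2

/-- **A point swallowed at a finite time is carried onto the driving function**: if `z ∈ ℍ`
has `T_z = τ < ∞`, then `g_t(z) - W_t → 0` as `t ↗ τ` (the full limit; Lawler (2005), §4.1:
"`lim_{t → T_z-} [g_t(z) - U_t] = 0`"). From the quantitative form with `M = ε/4` (uniform
continuity of `W` on `[0, τ]`) and `δ = ε/4`. [cite: Lawler2005, Ch. 4 §4.1] -/
theorem tendsto_map_sub_driving_of_swallowingTime_eq (hW : Continuous W) (hz : z ∈ upperHalfPlaneSet)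
    {τ : ℝ≥0} (hτ : swallowingTime W z = τ) :
    Tendsto (fun t : ℝ≥0 ↦ map W t z - W t) (𝓝[<] τ) (𝓝 0) := by
  rw [Metric.tendsto_nhds]
  intro ε hε
  obtain ⟨η₁, hη₁, hmod⟩ := exists_forall_abs_sub_driving_le hW τ (η := ε / 4) (by positivity)
  set η : ℝ := min η₁ ((ε / 4) ^ 2 / 4) with hηdef
  have hη : 0 < η := lt_min hη₁ (by positivity)
  have hS : {t : ℝ≥0 | (τ : ℝ) - η < t} ∈ 𝓝[<] τ :=
    mem_nhdsWithin_of_mem_nhds ((isOpen_Ioi.preimage NNReal.continuous_coe).mem_nhds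
      (by show (τ : ℝ) - η < τ; linarith))
  filter_upwards [hS, self_mem_nhdsWithin] with t ht htτ
  rw [mem_Iio] at htτ
  have htτ' : (t : ℝ) < τ := by exact_mod_cast htτ
  have hzt : z ∈ domain W t := (mem_domain_iff W t z).2 ⟨hz, by rw [hτ]; exact_mod_cast htτ⟩
  have hM : ∀ u ∈ Icc (t : ℝ) τ, |W u.toNNReal - W t| ≤ ε / 4 := by
    intro u hu
    have h1 := hmod u ⟨t.coe_nonneg.trans hu.1, hu.2⟩ t ⟨t.coe_nonneg, htτ'.le⟩
      (by rw [abs_of_nonneg (by linarith [hu.1])]; linarith [hu.2, min_le_left η₁ ((ε / 4) ^ 2 / 4)])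
    rwa [Real.toNNReal_coe] at h1
  have hδt : 4 * ((τ : ℝ) - t) ≤ (ε / 4) ^ 2 := by
    linarith [min_le_right η₁ ((ε / 4) ^ 2 / 4)]
  have h := norm_map_sub_driving_lt_of_swallowingTime_eq hW hzt hτ hM (by positivity) hδt
  rw [dist_zero_right]
  linarith

/-- The same limit for the imaginary part: `Im g_t(z) → 0` as `t ↗ T_z`. [folklore] -/
theorem tendsto_im_map_of_swallowingTime_eq (hW : Continuous W) (hz : z ∈ upperHalfPlaneSet)
    {τ : ℝ≥0} (hτ : swallowingTime W z = τ) :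
    Tendsto (fun t : ℝ≥0 ↦ (map W t z).im) (𝓝[<] τ) (𝓝 0) := by
  have h := (Complex.continuous_im.tendsto 0).comp (tendsto_map_sub_driving_of_swallowingTime_eq hW hz hτ)
  have heq : (fun t : ℝ≥0 ↦ (map W t z).im) = Complex.im ∘ fun t ↦ map W t z - (W t : ℂ) := by
    ext t
    simp
  rw [heq]
  simpa using h

/-! ### Wholly swallowed components -/

/-- A univalent map of a disc into the upper half-plane, with the centre sent to `w`, has
`r |f'(c)| / 4 ≤ Im w` — Koebe's one-quarter theorem: the disc `B(w, r|f'(c)|/4)` lies in the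
image, hence in `ℍ`, but the real point below `w` is not in `ℍ`. [folklore] -/
theorem mul_norm_deriv_div_four_le_im {f : ℂ → ℂ} {c : ℂ} {r : ℝ} (hr : 0 < r)
    (hf : DifferentiableOn ℂ f (ball c r)) (hinj : InjOn f (ball c r))
    (hH : MapsTo f (ball c r) upperHalfPlaneSet) : r * ‖deriv f c‖ / 4 ≤ (f c).im := by
  by_contra hlt
  rw [not_le] at hlt
  -- Koebe's one-quarter theorem on `B(c, r)` (rescaled from the unit disc)
  have hsub : ball (f c) (r * ‖deriv f c‖ / 4) ⊆ f '' ball c r := by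
    obtain ⟨hFd, hFinj, hFderiv⟩ := Literature.Analysis.Complex.AreaThm.rescale_ball hr hf hinj
    have hK := Literature.Analysis.Complex.koebeQuarter_holds _ hFd hFinj
    have h0 : deriv (fun ζ ↦ f (c + r * ζ)) 0 = r * deriv f c := by
      have := hFderiv 0 (mem_ball_self one_pos); simpa using this
    simp only [mul_zero, add_zero, h0, norm_mul, Complex.norm_real, Real.norm_eq_abs,
      abs_of_pos hr] at hK
    refine (by simpa [mul_div_assoc] using hK : ball (f c) (r * ‖deriv f c‖ / 4) ⊆ _).trans ?_
    rintro _ ⟨ζ, hζ, rfl⟩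
    refine ⟨c + r * ζ, ?_, rfl⟩
    rw [mem_ball, dist_eq_norm, add_sub_cancel_left, norm_mul, Complex.norm_real, Real.norm_eq_abs,
      abs_of_pos hr]
    rw [mem_ball_zero_iff] at hζ
    nlinarith
  -- the real point below `f c`
  have hmem : ((f c).re : ℂ) ∈ ball (f c) (r * ‖deriv f c‖ / 4) := by
    rw [mem_ball, dist_eq_norm]
    have : ((f c).re : ℂ) - f c = -(((f c).im : ℂ) * Complex.I) :=
      Complex.ext (by simp) (by simp)
    rw [this, norm_neg, norm_mul, Complex.norm_real, Complex.norm_I, mul_one, Real.norm_eq_abs]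
    have h0 : 0 ≤ (f c).im := le_of_lt (hH (mem_ball_self hr))
    rwa [abs_of_nonneg h0]
  obtain ⟨x, hx, hfx⟩ := hsub hmem
  have h1 : 0 < (f x).im := hH hx
  rw [hfx, Complex.ofReal_im] at h1
  exact lt_irrefl _ h1

/-- **Wholly swallowed components.** Let `W` be continuous and `V ⊆ ℍ` open and preconnected
with `τ ≤ T_z` for every `z ∈ V` (i.e. `V` misses `K̂_s` for all `s < τ`). Then either EVERY
point of `V` is swallowed exactly at time `τ`, or NO point of `V` is swallowed by time `τ`.
Proof: both alternatives define open subsets of `V`. For the first: if `T_z = τ` and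
`B(z, r) ⊆ V`, the maps `f_t = g_t - W_t` (`t < τ`) are univalent on `B(z, r) ⊆ H_t` with values
in `ℍ` and `f_t(z) → 0` (`tendsto_map_sub_driving_of_swallowingTime_eq`), so Koebe's one-quarter
theorem gives `r|f_t'(z)|/4 ≤ Im f_t(z)` and the growth theorem `|f_t(w) - f_t(z)| ≤ 2r|f_t'(z)|`
on `B(z, r/2)`; hence `f_t(w) → 0` too, which is impossible for a point alive beyond `τ`
(`IsSolution.exists_le_norm_sub`). This is the deterministic content of [LSW]'s "rather obvious
fact `K_T ∩ A ⊂ ∂A`" (proof of Lemma 6.3, first paragraph).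
[cite: LawlerSchrammWerner2003Restriction, proof of Lemma 6.3 (first paragraph)] -/
theorem swallowingTime_eq_or_lt_of_isPreconnected (hW : Continuous W) {V : Set ℂ} (hVo : IsOpen V)
    (hVc : IsPreconnected V) (hVH : V ⊆ upperHalfPlaneSet) {τ : ℝ≥0}
    (hV : ∀ z ∈ V, (τ : WithTop ℝ≥0) ≤ swallowingTime W z) :
    (∀ z ∈ V, swallowingTime W z = τ) ∨ ∀ z ∈ V, (τ : WithTop ℝ≥0) < swallowingTime W z := by
  -- the two open sets
  set U₁ : Set ℂ := {z : ℂ | (τ : WithTop ℝ≥0) < swallowingTime W z} with hU₁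
  set U₂ : Set ℂ := {z : ℂ | z ∈ V ∧ swallowingTime W z = τ} with hU₂
  have hU₁o : IsOpen U₁ := isOpen_setOf_lt_swallowingTime hW τ
  -- `U₂` is open: the Koebe argument
  have hU₂o : IsOpen U₂ := by
    rw [Metric.isOpen_iff]
    rintro z ⟨hzV, hzτ⟩
    obtain ⟨r, hr, hball⟩ := Metric.isOpen_iff.1 hVo z hzV
    refine ⟨r / 2, half_pos hr, fun w hw ↦ ?_⟩
    have hwV : w ∈ V := hball (ball_subset_ball (by linarith) hw)
    refine ⟨hwV, le_antisymm (not_lt.1 fun hwτ ↦ ?_) (hV w hwV)⟩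
    -- `w` alive beyond `τ`: its flow stays `δ`-away from `W` on `[0, τ]`
    have hwH : w ∈ upperHalfPlaneSet := hVH hwV
    have hw0 : w ≠ W 0 := ne_driving_of_lt_swallowingTime hwτ
    obtain ⟨G, hG⟩ := exists_isSolution_swallowingTime_holds hW hw0
    have hτT : (((τ : ℝ)).toNNReal : WithTop ℝ≥0) < swallowingTime W w := by simpa using hwτ
    obtain ⟨δ, hδ, hfar⟩ := hG.exists_le_norm_sub hW τ.coe_nonneg hτT
    -- `τ > 0` and the limit `f_t(z) → 0`
    have hzH : z ∈ upperHalfPlaneSet := hVH hzV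
    have hτ0 : 0 < τ := by
      have hz0 : z ≠ W 0 := fun h ↦ by
        have : z.im = 0 := by rw [h, Complex.ofReal_im]
        exact absurd this (ne_of_gt hzH)
      have h0 : (0 : WithTop ℝ≥0) < swallowingTime W z := swallowingTime_pos_holds hW hz0
      rw [hzτ] at h0
      exact_mod_cast h0
    haveI : (𝓝[<] τ).NeBot := nhdsLT_neBot_of_exists_lt ⟨0, hτ0⟩
    have hlim := tendsto_map_sub_driving_of_swallowingTime_eq hW hzH hzτ
    rw [Metric.tendsto_nhds] at hlim
    obtain ⟨t, ht, htτ⟩ := ((hlim ((δ : ℝ) / 9) (by positivity)).and self_mem_nhdsWithin).exists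
    replace htτ : t < τ := htτ
    rw [dist_zero_right] at ht
    -- `f_t` is univalent on `B(z, r) ⊆ H_t` with values in `ℍ`
    set f : ℂ → ℂ := fun x ↦ map W t x - (W t : ℂ) with hf
    have hballH : ball z r ⊆ domain W t := fun x hx ↦
      (mem_domain_iff W t x).2 ⟨hVH (hball hx), lt_of_lt_of_le (by exact_mod_cast htτ) (hV x (hball hx))⟩
    have hfd : DifferentiableOn ℂ f (ball z r) :=
      ((differentiableOn_map hW t).mono hballH).sub_const _
    have hfinj : InjOn f (ball z r) := fun x hx y hy hxy ↦
      (injOn_map hW t) (hballH hx) (hballH hy) (sub_left_injective hxy)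
    have hfH : MapsTo f (ball z r) upperHalfPlaneSet := fun x hx ↦ by
      show 0 < (map W t x - (W t : ℂ)).im
      rw [Complex.sub_im, Complex.ofReal_im, sub_zero]
      exact mapsTo_map hW t (hballH hx)
    have hderiv : deriv f z = deriv (map W t) z := by
      rw [hf, deriv_sub_const]
    -- Koebe and growth
    have hK := mul_norm_deriv_div_four_le_im hr hfd hfinj hfH
    have hw' : ‖w - z‖ ≤ r / 2 := by rw [mem_ball, dist_eq_norm] at hw; exact hw.le
    obtain ⟨-, -, hgrowth⟩ := Literature.Analysis.Complex.AreaThm.distortion_half_ball hr hfd hfinj hw'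
    have himf : (f z).im ≤ ‖f z‖ := by
      refine (abs_le.1 (Complex.abs_im_le_norm (f z))).2
    have h1 : ‖f w‖ ≤ ‖f z‖ + 8 * ‖f z‖ := by
      calc ‖f w‖ = ‖(f w - f z) + f z‖ := by ring_nf
        _ ≤ ‖f w - f z‖ + ‖f z‖ := norm_add_le _ _
        _ ≤ 2 * r * ‖deriv f z‖ + ‖f z‖ := by gcongr
        _ ≤ 8 * (f z).im + ‖f z‖ := by nlinarith [hK]
        _ ≤ ‖f z‖ + 8 * ‖f z‖ := by linarith
    -- but `f w = G t - W t` is `δ`-far from `0`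
    have hGt : map W t w = G t := map_eq_of_isSolution hW hG (by exact_mod_cast hwτ.trans_le' (by exact_mod_cast htτ.le))
    have h2 : (δ : ℝ) ≤ ‖f w‖ := by
      have := hfar t ⟨t.coe_nonneg, by exact_mod_cast htτ.le⟩
      rw [Real.toNNReal_coe] at this
      simpa [hf, hGt] using this
    have h3 : ‖f z‖ < δ / 9 := ht
    linarith
  -- connectedness
  have hsub : V ⊆ U₁ ∪ U₂ := fun x hx ↦ by
    rcases (hV x hx).lt_or_eq with h | h
    · exact Or.inl h
    · exact Or.inr ⟨hx, h.symm⟩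
  have hdisj : Disjoint U₁ U₂ := Set.disjoint_left.2 fun x hx₁ hx₂ ↦ by
    rw [hU₂, mem_setOf_eq] at hx₂
    rw [hU₁, mem_setOf_eq, hx₂.2] at hx₁
    exact lt_irrefl _ hx₁
  rcases hVc.subset_or_subset hU₁o hU₂o hdisj hsub with h | h
  · exact Or.inr fun x hx ↦ h hx
  · exact Or.inl fun x hx ↦ (h hx).2

end Loewner

end Literature.Probability.RandomPlanarGeometry
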